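import Summits.Ventures.PercRepro.S1TriangleCount

/-!
# PercRepro — THE SHARP TRIANGLE COUNT AT BOUNDED NULLITY: `2·s₃ ≤ ν(ν − 1) + 2` under (C1) (p8, gen 19; a feeder for
S4 — the top of the `q = 7` window, the row `67`)

LEMMA T (`S1.two_mul_ncard_triangles_le`: `2·s₃ ≤ ν(ν + 1)`) pays `t_e ≤ ν` for the triangles through the deleted point
`e` at EVERY step of its deletion induction; that bound is attained only when every triangle passes through `e`. The
refinement: **if some triangle `T` avoids the non-loop `x`, then `t_x + 1 ≤ ν`** (`ncard_trianglesThrough_add_one_le`) —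
the set `W = T ∪ {x} ∪ ⋃(triangles through x)` has nullity `≥ 1 + t_x`: `T ∪ {x}` has `4` points and rank `≤ 3`
(nullity `≥ 1`), and each triangle `C` through `x` meets the set built so far in a PROPER subset of `C` (two triangles
through `x` meet only in `x` under (C1); `C ∖ {x} ⊆ T` would put `x` on the line of `T`, a rank-`2` set of `4` points),
so it adds `|C ∖ W| = 3 − |C ∩ W|` points and at most `2 − |C ∩ W|` to the rank (submodularity with `C ∩ W` independent):
the nullity grows by `≥ 1` per triangle. Hence in the deletion induction either every triangle passes through `e`
(`s₃ = t_e ≤ ν`) or `t_e ≤ ν − 1`, and `2·s₃ ≤ 2(ν − 1) + (ν − 1)(ν − 2) + 2 = ν(ν − 1) + 2`: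
**`s₃ ≤ C(ν, 2) + 1`** (`two_mul_ncard_triangles_le_sharp`). Tight at `ν = 1, 2` (one / two triangles), `ν = 3`
(`K₄`: four) and `ν = 4` (the Fano plane: seven). Against LEMMA T at `ν = 14`: `92` against `105`, the cells
`(67, 14 … 16)` of the level-`7` chain.

* **`eRk_add_le_ncard_of_triangles_of_avoid`** — the nullity of `W` grows by one per triangle through `x`;
* **`ncard_trianglesThrough_add_one_le`** — `t_x + 1 ≤ ν` when a triangle avoids `x`;
* **`two_mul_ncard_triangles_le_sharp`** — `2·s₃ ≤ ν(ν − 1) + 2`.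
Axioms: standard.
-/

open scoped Matroid

namespace PercRepro

namespace S1

open Set

variable {α : Type}

/-- **The nullity of `T ∪ {x} ∪ ⋃(triangles through `x`) grows by one per triangle**: for a triangle `T` avoiding the
non-loop `x` and a finite set `s` of triangles through `x`, `r(W) + 1 + |s| ≤ |W|` where
`W = insert x T ∪ ⋃_{C ∈ s} C` (under (C1)). -/
theorem eRk_add_le_ncard_of_triangles_of_avoid (M : Matroid α) [M.Finite]
    (hC1 : ∀ L ⊆ M.E, M.eRk L = 2 → L.ncard ≤ 3) {x : α} (hx : M.IsNonloop x)
    {T : Set α} (hT : T ∈ ThmN.triangles M) (hxT : x ∉ T)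
    (s : Finset (Set α)) (hs : ∀ C ∈ s, C ∈ ThmN.trianglesThrough M x) :
    M.eRk (insert x T ∪ ⋃ C ∈ s, C) + ((1 + s.card : ℕ) : ℕ∞) ≤
      ((insert x T ∪ ⋃ C ∈ s, C).ncard : ℕ∞) := by
  classical
  have hxE : x ∈ M.E := hx.mem_ground
  have hTE : T ⊆ M.E := hT.1.subset_ground
  have hTfin : T.Finite := M.ground_finite.subset hTE
  have hT3 : T.ncard = 3 := hT.2
  have hTr : M.eRk T = 2 := by
    have h := hT.1.eRk_add_one_eq
    rw [← hTfin.cast_ncard_eq, hT3] at h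
    have hne : M.eRk T ≠ ⊤ := ((M.eRk_le_encard _).trans_lt hTfin.encard_lt_top).ne
    obtain ⟨r, hr⟩ := ENat.ne_top_iff_exists.1 hne
    rw [← hr] at h ⊢
    have h' : r + 1 = 3 := by exact_mod_cast h
    have : r = 2 := by omega
    rw [this]; norm_num
  -- `x` is not on the line of `T`: `insert x T` has `4` points, so its rank is not `2`
  have hxcl : x ∉ M.closure T := by
    intro hxcl
    have h1 : M.eRk (insert x T) = 2 := by
      rw [← M.eRk_closure_eq, Matroid.closure_insert_eq_of_mem_closure hxcl, M.eRk_closure_eq, hTr]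
    have h2 := hC1 (insert x T) (insert_subset hxE hTE) h1
    rw [ncard_insert_of_notMem hxT hTfin, hT3] at h2
    omega
  induction s using Finset.induction_on with
  | empty =>
    simp only [Finset.notMem_empty, Set.iUnion_of_empty, Set.iUnion_empty, Set.union_empty,
      Finset.card_empty, add_zero, Nat.cast_one]
    rw [ncard_insert_of_notMem hxT hTfin, hT3]
    have h := M.eRk_insert_le_add_one x T
    rw [hTr] at h
    calc M.eRk (insert x T) + 1 ≤ 2 + 1 + 1 := by gcongr
      _ = ((4 : ℕ) : ℕ∞) := by norm_num
  | insert C₀ s hC₀s ih =>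
    have hs' : ∀ C ∈ s, C ∈ ThmN.trianglesThrough M x := fun C hC => hs C (Finset.mem_insert_of_mem hC)
    have ih' := ih hs'
    have hC₀ : C₀ ∈ ThmN.trianglesThrough M x := hs C₀ (Finset.mem_insert_self C₀ s)
    set W : Set α := insert x T ∪ ⋃ C ∈ s, C with hW
    have hxW : x ∈ W := Set.mem_union_left _ (Set.mem_insert x T)
    have hWE : W ⊆ M.E := by
      intro z hz
      rcases hz with hz | hz
      · rcases hz with rfl | hz
        · exact hxE
        · exact hTE hz
      · obtain ⟨C, hC, hzC⟩ := Set.mem_iUnion₂.1 hz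
        exact (hs' C hC).1.subset_ground hzC
    have hWfin : W.Finite := M.ground_finite.subset hWE
    have hC₀E : C₀ ⊆ M.E := hC₀.1.subset_ground
    have hC₀fin : C₀.Finite := M.ground_finite.subset hC₀E
    have hC₀r : M.eRk C₀ = 2 := ThmN.eRk_eq_two_of_mem_trianglesThrough M hC₀
    have hnew : insert x T ∪ ⋃ C ∈ insert C₀ s, C = C₀ ∪ W := by
      rw [hW, Finset.set_biUnion_insert]
      ext z
      simp only [Set.mem_union]
      tauto
    -- `C₀ ⊄ W`: a point of `C₀ ∖ {x}` in a triangle of `s` contradicts «meet only in `x`», and `C₀ ∖ {x} ⊆ T`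
    -- would put `x` on the line of `T`
    have hnsub : ¬ C₀ ⊆ W := by
      intro hsub
      have hdiff : C₀ \ {x} ⊆ T := by
        intro z hz
        have hzW := hsub hz.1
        have hzx : z ≠ x := fun h => hz.2 (h ▸ Set.mem_singleton z)
        rcases hzW with hzW | hzW
        · rcases hzW with rfl | hzW
          · exact absurd rfl hzx
          · exact hzW
        · obtain ⟨C, hC, hzC⟩ := Set.mem_iUnion₂.1 hzW
          have hne : C₀ ≠ C := fun h => hC₀s (h ▸ hC)
          have hint := ThmN.inter_eq_singleton_of_mem_trianglesThrough M hC1 hC₀ (hs' C hC) hne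
          have : z ∈ C₀ ∩ C := ⟨hz.1, hzC⟩
          rw [hint] at this
          exact absurd (Set.mem_singleton_iff.1 this) hzx
      have h1 : x ∈ M.closure (C₀ \ {x}) := hC₀.1.mem_closure_sdiff_singleton_of_mem hC₀.2.2
      exact hxcl (M.closure_subset_closure hdiff h1)
    have hssub : C₀ ∩ W ⊂ C₀ := by
      refine Set.inter_subset_left.ssubset_of_ne ?_
      intro h
      exact hnsub (by rw [← h]; exact Set.inter_subset_right)
    have hind : M.Indep (C₀ ∩ W) := hC₀.1.ssubset_indep hssub
    have hindr : M.eRk (C₀ ∩ W) = ((C₀ ∩ W).ncard : ℕ∞) := by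
      rw [hind.eRk_eq_encard, (hC₀fin.subset Set.inter_subset_left).cast_ncard_eq]
    have hsub := M.eRk_inter_add_eRk_union_le C₀ W
    rw [hC₀r, hindr] at hsub
    have hcard : (C₀ ∪ W).ncard = W.ncard + (C₀ \ W).ncard := by
      rw [Set.union_comm, ← Set.union_sdiff_self,
        Set.ncard_union_eq Set.disjoint_sdiff_right hWfin (hC₀fin.sdiff)]
    have hcard2 : (C₀ ∩ W).ncard + (C₀ \ W).ncard = C₀.ncard :=
      Set.ncard_inter_add_ncard_sdiff_eq_ncard C₀ W hC₀fin
    rw [hnew, Finset.card_insert_of_notMem hC₀s, hcard]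
    -- pass to `ℕ`
    have hneU : M.eRk (C₀ ∪ W) ≠ ⊤ :=
      ((M.eRk_le_encard _).trans_lt (hC₀fin.union hWfin).encard_lt_top).ne
    have hneW : M.eRk W ≠ ⊤ := ((M.eRk_le_encard _).trans_lt hWfin.encard_lt_top).ne
    obtain ⟨a, ha⟩ := ENat.ne_top_iff_exists.1 hneU
    obtain ⟨b, hb⟩ := ENat.ne_top_iff_exists.1 hneW
    rw [← ha, ← hb] at hsub
    rw [← hb] at ih'
    rw [← ha]
    have e1 : (C₀ ∩ W).ncard + a ≤ 2 + b := by exact_mod_cast hsub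
    have e2 : b + (1 + s.card) ≤ W.ncard := by exact_mod_cast ih'
    have e3 : a + (1 + (s.card + 1)) ≤ W.ncard + (C₀ \ W).ncard := by
      have := hC₀.2.1
      omega
    exact_mod_cast e3

/-- **A triangle avoiding `x` sharpens the star bound by one**: if `|E| = r(E) + d`, every rank-`2` set has `≤ 3`
elements and some triangle `T` avoids the non-loop `x`, then at most `d − 1` triangles pass through `x`:
`t_x + 1 ≤ d`. -/
theorem ncard_trianglesThrough_add_one_le (M : Matroid α) [M.Finite]
    (hC1 : ∀ L ⊆ M.E, M.eRk L = 2 → L.ncard ≤ 3) {x : α} (hx : M.IsNonloop x)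
    {T : Set α} (hT : T ∈ ThmN.triangles M) (hxT : x ∉ T) {d : ℕ}
    (hd : M.E.encard = M.eRank + d) : (ThmN.trianglesThrough M x).ncard + 1 ≤ d := by
  classical
  have hTfin' : (ThmN.trianglesThrough M x).Finite :=
    M.ground_finite.finite_subsets.subset (fun C hC => hC.1.subset_ground)
  set s := hTfin'.toFinset with hsdef
  have hs : ∀ C ∈ s, C ∈ ThmN.trianglesThrough M x := fun C hC => (Set.Finite.mem_toFinset hTfin').1 hC
  have hscard : s.card = (ThmN.trianglesThrough M x).ncard := by
    rw [hsdef, ← Set.ncard_eq_toFinset_card _ hTfin']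
  have hinv := eRk_add_le_ncard_of_triangles_of_avoid M hC1 hx hT hxT s hs
  set W : Set α := insert x T ∪ ⋃ C ∈ s, C with hW
  have hWE : W ⊆ M.E := by
    intro z hz
    rcases hz with hz | hz
    · rcases hz with rfl | hz
      · exact hx.mem_ground
      · exact hT.1.subset_ground hz
    · obtain ⟨C, hC, hzC⟩ := Set.mem_iUnion₂.1 hz
      exact (hs C hC).1.subset_ground hzC
  have hWfin : W.Finite := M.ground_finite.subset hWE
  -- `r(E) ≤ r(W) + |E ∖ W|`
  have hrE : M.eRank ≤ M.eRk W + (M.E \ W).encard := by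
    have := M.eRk_union_le_eRk_add_encard W (M.E \ W)
    rwa [Set.union_sdiff_cancel hWE, M.eRk_ground] at this
  have hcard : M.E.ncard = W.ncard + (M.E \ W).ncard := by
    conv_lhs => rw [← Set.union_sdiff_cancel hWE]
    exact Set.ncard_union_eq Set.disjoint_sdiff_right hWfin (M.ground_finite.sdiff)
  have hneW : M.eRk W ≠ ⊤ := ((M.eRk_le_encard _).trans_lt hWfin.encard_lt_top).ne
  obtain ⟨a, ha⟩ := ENat.ne_top_iff_exists.1 hneW
  have hneR : M.eRank ≠ ⊤ :=
    (M.eRank_le_encard_ground.trans_lt M.ground_finite.encard_lt_top).ne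
  obtain ⟨r, hr'⟩ := ENat.ne_top_iff_exists.1 hneR
  rw [← ha, ← hr', ← (M.ground_finite.sdiff (t := W)).cast_ncard_eq] at hrE
  rw [← ha] at hinv
  rw [← hr', ← M.ground_finite.cast_ncard_eq] at hd
  have e1 : r ≤ a + (M.E \ W).ncard := by exact_mod_cast hrE
  have e2 : a + (1 + s.card) ≤ W.ncard := by exact_mod_cast hinv
  have e3 : M.E.ncard = r + d := by exact_mod_cast hd
  rw [← hscard]
  omega

/-- **THE SHARP TRIANGLE COUNT at bounded nullity.** If `|E| = r(E) + d` and every rank-`2` set has at most `3`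
elements, then `2·#(triangles M) ≤ d·(d − 1) + 2`, i.e. `s₃ ≤ C(d, 2) + 1`. Deletion induction on `|E|`: for a point
`e` of a triangle, either every triangle passes through `e` (`s₃ = t_e ≤ d ≤ C(d, 2) + 1`) or some triangle avoids it
and `t_e + 1 ≤ d`, the others being the triangles of `M ＼ {e}` (nullity `d − 1`). -/
theorem two_mul_ncard_triangles_le_sharp (M : Matroid α) [M.Finite]
    (hC1 : ∀ L ⊆ M.E, M.eRk L = 2 → L.ncard ≤ 3) {d : ℕ} (hd : M.E.encard = M.eRank + d) :
    2 * (ThmN.triangles M).ncard ≤ d * (d - 1) + 2 := by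
  suffices H : ∀ n : ℕ, ∀ (M : Matroid α) [M.Finite], M.E.ncard = n →
      (∀ L ⊆ M.E, M.eRk L = 2 → L.ncard ≤ 3) → ∀ d : ℕ, M.E.encard = M.eRank + d →
      2 * (ThmN.triangles M).ncard ≤ d * (d - 1) + 2 from H _ M rfl hC1 d hd
  intro n
  induction n using Nat.strong_induction_on with
  | _ n ih =>
  intro M _ hn hC1 d hd
  classical
  set S := ThmN.triangles M with hS
  have hSfin : S.Finite :=
    M.ground_finite.finite_subsets.subset (fun C hC => hC.1.subset_ground)
  by_cases hSe : S = ∅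
  · rw [hSe, ncard_empty]; exact Nat.zero_le _
  obtain ⟨C₀, hC₀⟩ := nonempty_iff_ne_empty.2 hSe
  obtain ⟨e, heC₀⟩ := hC₀.1.nonempty
  have heE : e ∈ M.E := hC₀.1.subset_ground heC₀
  have hne : ¬ M.IsColoop e := hC₀.1.not_isColoop_of_mem heC₀
  have hν : M✶.eRank = (d : ℕ∞) := by
    have h := _root_.Matroid.eRank_add_eRank_dual M
    rw [hd] at h
    exact WithTop.add_left_cancel (PercRepro.Matroid.eRank_ne_top_of_finite M) h
  have hdel := PercRepro.Matroid.dual_eRank_delete_singleton_add_one heE hne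
  rw [hν] at hdel
  have hfin' : (M ＼ {e})✶.eRank ≠ ⊤ := by
    intro h
    rw [h] at hdel
    exact absurd hdel (by simp)
  obtain ⟨d', hd'⟩ := ENat.ne_top_iff_exists.1 hfin'
  have hdd' : d = d' + 1 := by
    rw [← hd'] at hdel
    exact_mod_cast hdel.symm
  have hd'enc : (M ＼ {e}).E.encard = (M ＼ {e}).eRank + d' := by
    have h := _root_.Matroid.eRank_add_eRank_dual (M ＼ {e})
    rw [← hd'] at h
    exact h.symm
  have hdelE : (M ＼ {e}).E.ncard < n := by
    rw [_root_.Matroid.delete_ground, ← hn, ← ncard_sdiff_singleton_add_one heE M.ground_finite]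
    omega
  have hC1' : ∀ L ⊆ (M ＼ {e}).E, (M ＼ {e}).eRk L = 2 → L.ncard ≤ 3 := by
    intro L hL hr
    rw [_root_.Matroid.delete_ground] at hL
    rw [delete_singleton_eRk_eq hL] at hr
    exact hC1 L (hL.trans sdiff_subset) hr
  set S₁ := ThmN.trianglesThrough M e with hS₁
  set S₂ := {C | M.IsCircuit C ∧ C.ncard = 3 ∧ e ∉ C} with hS₂
  have hsplit : S ⊆ S₁ ∪ S₂ := by
    intro C hC
    by_cases h : e ∈ C
    · exact Or.inl ⟨hC.1, hC.2, h⟩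
    · exact Or.inr ⟨hC.1, hC.2, h⟩
  have hS₁fin : S₁.Finite := hSfin.subset (fun C hC => ⟨hC.1, hC.2.1⟩)
  have hS₂fin : S₂.Finite := hSfin.subset (fun C hC => ⟨hC.1, hC.2.1⟩)
  have hx : M.IsNonloop e := by
    refine _root_.Matroid.isNonloop_of_not_isLoop heE ?_
    intro hloop
    have hC₀e : C₀ = {e} := hloop.eq_of_isCircuit_mem hC₀.1 heC₀
    have := hC₀.2
    rw [hC₀e, ncard_singleton] at this
    omega
  have h3 : S.ncard ≤ S₁.ncard + S₂.ncard :=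
    (ncard_le_ncard hsplit (hS₁fin.union hS₂fin)).trans (ncard_union_le _ _)
  by_cases hS₂e : S₂ = ∅
  · -- every triangle passes through `e`: `s₃ = t_e ≤ d`
    have h1 : S₁.ncard ≤ d := ThmN.ncard_trianglesThrough_le M hC1 hx hd
    have h2 : S₂.ncard = 0 := by rw [hS₂e, ncard_empty]
    have h4 : S.ncard ≤ d := by omega
    subst hdd'
    rcases d' with _ | d'
    · omega
    · rw [show d' + 1 + 1 - 1 = d' + 1 by omega]
      nlinarith [h4]
  · -- some triangle avoids `e`: `t_e + 1 ≤ d`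
    obtain ⟨T, hT⟩ := nonempty_iff_ne_empty.2 hS₂e
    have hTtri : T ∈ ThmN.triangles M := ⟨hT.1, hT.2.1⟩
    have h1 : S₁.ncard + 1 ≤ d := ncard_trianglesThrough_add_one_le M hC1 hx hTtri hT.2.2 hd
    have h2 : 2 * S₂.ncard ≤ d' * (d' - 1) + 2 := by
      have hsub : S₂ ⊆ ThmN.triangles (M ＼ {e}) := by
        intro C hC
        exact ⟨_root_.Matroid.delete_isCircuit_iff.2 ⟨hC.1, disjoint_singleton_right.2 hC.2.2⟩, hC.2.1⟩
      calc 2 * S₂.ncard ≤ 2 * (ThmN.triangles (M ＼ {e})).ncard := by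
            apply Nat.mul_le_mul_left
            exact ncard_le_ncard hsub
              ((M ＼ {e}).ground_finite.finite_subsets.subset (fun C hC => hC.1.subset_ground))
        _ ≤ d' * (d' - 1) + 2 := ih _ hdelE (M ＼ {e}) rfl hC1' d' hd'enc
    subst hdd'
    rw [show d' + 1 - 1 = d' by omega]
    rcases d' with _ | d'
    · omega
    · rw [show d' + 1 - 1 = d' by omega] at h2
      nlinarith [h1, h2, h3]

end S1

end PercRepro
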